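import Literature.AnabelianGeometry.SemiGraphs.SgAToProfiniteCompare
import HarnessLib

/-!
# [SemiAnbd] §2/§3: `B(𝒢) ⥤ B(𝒢.toProfinite.toAnab) ⥤ B^cov(𝒢.toProfinite)` — finite étale covering
# data through the fibre functors (bridge B6)

Mochizuki, *Semi-graphs of anabelioids*, Publ. RIMS **42** (2006), Def. 2.1 p. 23 (`B(𝒢)`: data
`{S_v, T_e, ψ_b}`), Def. 3.5 (i) p. 37 ("we have a natural full embedding `B(𝒢) ↪ B^cov(𝒢)`. An
object of `B^cov(𝒢)` that lies in the essential image of `B(𝒢)` will be called finite") (kurims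
`paper:url-f33ace170ff4`). [cite: MochizukiSemiAnbd2006, Def 3.5(i) p.37]

Step B6 of the (R1) bridge (HOME/staging/L3/L3-t3/R1-BRIDGE-SHAPES.md §2, the OBJECT half of law L1
«finite étale ⇒ tempered»; interface owner abc-iut-L3-t3), over B3 `SgAToProfiniteCompare.lean` and
abc-iut-L3-t2's `FiniteCoveringsComparison.lean` (`ProfiniteSemiGraph.ofBObj`):

* `SemiGraphOfAnabelioids.BObj.compare A : 𝒢.toProfinite.toAnab.BObj` — an object
  `A = {S_v, T_e, ψ_b}` of t1's `B(𝒢)` read through the fibre functors: `F_v(S_v)`, `F_e(T_e)` as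
  continuous finite `Π_v`-, `Π_e`-sets, glued by `(α_b)⁻¹ ≫ F_e(ψ_b)` (B3's 2-cell `compareBranchIso`);
  `BObj.compareFunctor : 𝒢.BObj ⥤ 𝒢.toProfinite.toAnab.BObj`;
* `SemiGraphOfAnabelioids.BObj.toCovObj A : CovObj 𝒢.toProfinite` := t2's `ofBObjObj` of it —
  **the finite object of `B^cov(𝒢.toProfinite)` attached to a finite étale covering datum of `𝒢`**;
  `BObj.toCovObjFunctor`; `toCovObj_isFinite` (it IS finite: fibres of fibre functors are finite).

Remaining for L1: the `IsoOver` (B4) between the profinite reading of t6's covering `𝒢_A → 𝒢`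
(`BObj.coveringHom A`, `CoveringOfObject.lean`) and `(BObj.toCovObj A).coveringHom` (components ↔
orbits: `Anabelioids/ComponentsOrbits.lean`; `Π_{v'} = Stab`: `range_pi1Map_eq_stabilizer`), and
`FiniteIsTempered_holds` for connected countable `𝒢`.  Definitions + bookkeeping only; nothing of the
paper is asserted; no side taken on [IUTchIII] Cor. 3.12.
-/

noncomputable section

namespace Literature.AnabelianGeometry.SemiGraphs

open CategoryTheory CategoryTheory.Limits CategoryTheory.PreGaloisCategory
open Literature.AnabelianGeometry.Anabelioids
open scoped FintypeCatDiscrete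

universe u

namespace SemiGraphOfAnabelioids

variable (𝒢 : SemiGraphOfAnabelioids.{u, u, u})

namespace BObj

variable {𝒢}

/-- **An object of `B(𝒢)` read through the fibre functors**: `{F_v(S_v), F_e(T_e), (α_b)⁻¹ ≫ F_e(ψ_b)}`,
an object of `B(𝒢.toProfinite.toAnab) = B({B(Π_v), B(Π_e), B(b_*)})`.
[cite: MochizukiSemiAnbd2006, Def. 2.1 p.23] -/
def compare (A : 𝒢.BObj) : 𝒢.toProfinite.toAnab.BObj where
  S v := (𝒢.compareV v).obj (A.S v)
  T e := (𝒢.compareE e).obj (A.T e)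
  ψ b v h := (𝒢.compareBranchIso b v h).app (A.S v) ≪≫ (𝒢.compareE _).mapIso (A.ψ b v h)

/-- The vertex objects of `compare A` are the fibres `F_v(S_v)` with their `Π_v`-action.
[cite: MochizukiSemiAnbd2006, Def. 2.1 p.23] -/
@[simp] theorem compare_S (A : 𝒢.BObj) (v : 𝒢.graph.Vertex) :
    (compare A).S v = (𝒢.compareV v).obj (A.S v) := rfl

/-- The edge objects of `compare A` are the fibres `F_e(T_e)` with their `Π_e`-action.
[cite: MochizukiSemiAnbd2006, Def. 2.1 p.23] -/
@[simp] theorem compare_T (A : 𝒢.BObj) (e : 𝒢.graph.Edge) :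
    (compare A).T e = (𝒢.compareE e).obj (A.T e) := rfl

/-- The gluings of `compare A`. [cite: MochizukiSemiAnbd2006, Def. 2.1 p.23] -/
theorem compare_ψ_hom (A : 𝒢.BObj) (b : 𝒢.graph.Branch) (v : 𝒢.graph.Vertex)
    (h : 𝒢.graph.abuts b = some v) :
    ((compare A).ψ b v h).hom =
      (𝒢.compareBranchIso b v h).hom.app (A.S v) ≫ (𝒢.compareE _).map (A.ψ b v h).hom := rfl

/-- `compare` on morphisms of `B(𝒢)`: apply the fibre functors componentwise (compatibility with the
gluings = naturality of B3's 2-cell + functoriality). [cite: MochizukiSemiAnbd2006, Def. 2.1 p.23] -/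
def compareMap {A B : 𝒢.BObj} (f : A ⟶ B) : compare A ⟶ compare B where
  fS v := (𝒢.compareV v).map (f.fS v)
  fT e := (𝒢.compareE e).map (f.fT e)
  comm b v h := by
    apply ObjectProperty.hom_ext
    apply Action.Hom.ext
    ext x
    change (𝒢.fibE (𝒢.graph.edgeOf b)).map (B.ψ b v h).hom
        ((𝒢.branchPath b v h).inv.app (B.S v) ((𝒢.fibV v).map (f.fS v) x)) =
      (𝒢.fibE (𝒢.graph.edgeOf b)).map (f.fT (𝒢.graph.edgeOf b))
        ((𝒢.fibE (𝒢.graph.edgeOf b)).map (A.ψ b v h).hom ((𝒢.branchPath b v h).inv.app (A.S v) x))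
    rw [NatTrans.naturality_apply (𝒢.branchPath b v h).inv (f.fS v) x, Functor.comp_map]
    have key := congrArg (fun k => (𝒢.fibE (𝒢.graph.edgeOf b)).map k
      ((𝒢.branchPath b v h).inv.app (A.S v) x)) (f.comm b v h)
    simp only [Functor.map_comp, FintypeCat.comp_apply] at key
    exact key

/-- **`B(𝒢) ⥤ B(𝒢.toProfinite.toAnab)`**: finite étale covering data of `𝒢` read through the fibre
functors. [cite: MochizukiSemiAnbd2006, Def. 2.1 p.23] -/
def compareFunctor : 𝒢.BObj ⥤ 𝒢.toProfinite.toAnab.BObj where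
  obj := compare
  map := compareMap
  map_id A := by
    refine BObj.hom_ext _ _ (funext fun v => ?_) (funext fun e => ?_)
    · exact (𝒢.compareV v).map_id _
    · exact (𝒢.compareE e).map_id _
  map_comp f g := by
    refine BObj.hom_ext _ _ (funext fun v => ?_) (funext fun e => ?_)
    · exact (𝒢.compareV v).map_comp _ _
    · exact (𝒢.compareE e).map_comp _ _

/-- **The finite object of `B^cov(𝒢.toProfinite)` attached to an object of `B(𝒢)`** ("`B(𝒢) ↪ B^cov(𝒢)`",
Def. 3.5 (i)): abc-iut-L3-t2's `ofBObjObj` of `compare A` — fibres `F_v(S_v)`, `F_e(T_e)` as countable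
`Π`-sets with open stabilisers, glued along the branches. [cite: MochizukiSemiAnbd2006, Def 3.5(i) p.37] -/
def toCovObj (A : 𝒢.BObj) : ProfiniteSemiGraph.CovObj 𝒢.toProfinite :=
  𝒢.toProfinite.ofBObjObj (compare A)

/-- **`B(𝒢) ⥤ B^cov(𝒢.toProfinite)`**. [cite: MochizukiSemiAnbd2006, Def 3.5(i) p.37] -/
def toCovObjFunctor : 𝒢.BObj ⥤ ProfiniteSemiGraph.CovObj 𝒢.toProfinite :=
  compareFunctor ⋙ 𝒢.toProfinite.ofBObj

/-- `toCovObjFunctor` on objects is `toCovObj`. [cite: MochizukiSemiAnbd2006, Def 3.5(i) p.37] -/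
@[simp] theorem toCovObjFunctor_obj (A : 𝒢.BObj) : toCovObjFunctor.obj A = toCovObj A := rfl

/-- The vertex fibre of `toCovObj A` over `v` is the finite set `F_v(S_v)`.
[cite: MochizukiSemiAnbd2006, Def 3.5(i) p.37] -/
theorem toCovObj_SV_V (A : 𝒢.BObj) (v : 𝒢.graph.Vertex) :
    ((toCovObj A).SV v).obj.V = ((𝒢.fibV v).obj (A.S v) : Type u) := rfl

/-- The edge fibre of `toCovObj A` over `e` is the finite set `F_e(T_e)`.
[cite: MochizukiSemiAnbd2006, Def 3.5(i) p.37] -/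
theorem toCovObj_SE_V (A : 𝒢.BObj) (e : 𝒢.graph.Edge) :
    ((toCovObj A).SE e).obj.V = ((𝒢.fibE e).obj (A.T e) : Type u) := rfl

/-- **`toCovObj A` is a FINITE object of `B^cov(𝒢.toProfinite)`** (its fibres are fibres of fibre
functors, finite sets) — "an object of `B^cov(𝒢)` that lies in the essential image of `B(𝒢)` will be
called finite". [cite: MochizukiSemiAnbd2006, Def 3.5(i) p.37] -/
theorem toCovObj_isFinite (A : 𝒢.BObj) : (toCovObj A).IsFinite := by
  refine ⟨fun v => ?_, fun e => ?_⟩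
  · change Finite ((𝒢.fibV v).obj (A.S v))
    infer_instance
  · change Finite ((𝒢.fibE e).obj (A.T e))
    infer_instance

/-- If every `S_v` and every `T_e` has a point in its fibre (e.g. is not initial), `toCovObj A` has
nonempty fibres. [cite: MochizukiSemiAnbd2006, Def 3.5(i) p.37] -/
theorem toCovObj_hasNonemptyFibres (A : 𝒢.BObj) (hS : ∀ v, Nonempty ((𝒢.fibV v).obj (A.S v)))
    (hT : ∀ e, Nonempty ((𝒢.fibE e).obj (A.T e))) : (toCovObj A).HasNonemptyFibres :=
  ⟨fun v => hS v, fun e => hT e⟩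

end BObj

end SemiGraphOfAnabelioids

end Literature.AnabelianGeometry.SemiGraphs

end
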